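import Mathlib
import Summits.Ventures.DiscreteObjects.Mahler.MRWTable1Kernel
import Summits.Ventures.DiscreteObjects.Mahler.CensusDeg10SalemA
import Summits.Ventures.DiscreteObjects.Mahler.CensusDeg10SalemB
import Summits.Ventures.DiscreteObjects.Mahler.CensusDeg12Salem
import Summits.Ventures.DiscreteObjects.Mahler.CensusDeg14Salem
import Summits.Ventures.DiscreteObjects.Mahler.CensusDeg1618Salem
import Summits.Ventures.DiscreteObjects.Mahler.CensusDeg18Salem
import Summits.Ventures.DiscreteObjects.Mahler.CensusDeg10Nu2
import Summits.Ventures.DiscreteObjects.Mahler.CensusDeg14Nu2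
import Summits.Ventures.DiscreteObjects.Mahler.CensusDeg16Nu2B
import Summits.Ventures.DiscreteObjects.Mahler.CensusDeg18Nu2A
import Summits.Ventures.DiscreteObjects.Mahler.CensusDeg18Nu2B
import Summits.Ventures.DiscreteObjects.Mahler.CensusDeg14Nu3
import Summits.Ventures.DiscreteObjects.Mahler.CensusDeg18Nu3A
import Summits.Ventures.DiscreteObjects.Mahler.CensusDeg18Nu3B
import Summits.Ventures.DiscreteObjects.Mahler.CensusDeg16TwoPairs
import Summits.Ventures.DiscreteObjects.Mahler.CensusDeg16Imprimitive

/-!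
# The census rows of degree 10–18 in the kernel: every listed core has `1 < M < 1.3`, and the row minima are MRW's `M_D` (venture `DiscreteObjects`, target L)

Cell `pub-namedobj`, seat `pub-namedobj-mahler` (gen 11). Framing: lottery ticket; floor = certified
bounds/negative ranges.

The cell's height-unrestricted census rows of degrees `10, 12, 14, 16, 18` (`CensusData10to18.coresDeg n`: 7, 5, 11, 16,
23 cores; a certified COMPUTATION, two engines) list the irreducible noncyclotomic integer polynomials with `1 < M < 13/10`
found by the enumeration.  With every core now kernel-enclosed to 8 decimals (Salem certificates gen 2/10; `ν = 2, 3`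
cofactor certificates and `ν = 4` disc certificates gen 11), this file states the KERNEL half of each row:

* `coresDeg{n}_measure_bounds` — every listed core of degree `n` indeed has `1 < M < 13/10` (no false positive in the
  row; the "every member of `L` has measure in `(1, B)`" clause of the census vocabulary);
* `coresDeg{n}_min` — the row minimum is the printed MRW08 Table-1 value: `M(mrwMinimalPoly n) ≤ M(l)` for every
  listed `l`, with equality attained at `c{n}_01 = mrwMinimalPoly n (-x)` (CONTROL REPRODUCED in the kernel, third engine);
* `census_le18_gap` — every listed core of degree `≤ 18` other than Lehmer's (`c10_01 = ℓ(-x)`) has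
  `M > 1.1883 > λ₀ + 0.012`: in degrees `≤ 18` the census isolates Lehmer's measure by a margin of `10⁻²`.

Completeness of the rows (no polynomial missed) remains the certified computation, not a theorem.
-/

namespace Summit.Ventures.DiscreteObjects.Mahler

open Polynomial Literature.NumberTheory.MahlerMeasure

/-- `c10_01 = ℓ(-x)` (Lehmer's polynomial in `-x`). -/
theorem ofCoeffs_c10_01_eq : ofCoeffs c10_01 = lehmerPoly.comp (-X) := by
  unfold ofCoeffs c10_01 lehmerPoly
  simp [List.zipIdx]
  ring

/-- `c14_01 = mrwPoly14(-x)`. -/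
theorem ofCoeffs_c14_01_eq : ofCoeffs c14_01 = mrwPoly14.comp (-X) := by
  unfold ofCoeffs c14_01
  simp [List.zipIdx, mrwPoly14]
  ring

/-- `c18_01 = mrwPoly18(-x)`. -/
theorem ofCoeffs_c18_01_eq : ofCoeffs c18_01 = mrwPoly18.comp (-X) := by
  unfold ofCoeffs c18_01
  simp [List.zipIdx, mrwPoly18]
  ring

/-- `1.176280818259 < M(c10_01) < 1.176280818260` (Lehmer's measure, 12 digits, from `LehmerExactMeasure`). -/
theorem c10_01_measure_enclosure :
    (1176280818259 / 10 ^ 12 : ℝ) < intMahlerMeasure (ofCoeffs c10_01) ∧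
      intMahlerMeasure (ofCoeffs c10_01) < 1176280818260 / 10 ^ 12 := by
  rw [ofCoeffs_c10_01_eq, intMahlerMeasure_comp_neg_X]; exact lehmer_measure_enclosure

/-- `1.20002652 < M(c14_01) < 1.20002653`. -/
theorem c14_01_measure_enclosure :
    (120002652 / 10 ^ 8 : ℝ) < intMahlerMeasure (ofCoeffs c14_01) ∧
      intMahlerMeasure (ofCoeffs c14_01) < 120002653 / 10 ^ 8 := by
  rw [ofCoeffs_c14_01_eq, intMahlerMeasure_comp_neg_X]; exact mrwPoly14_measure_enclosure

/-- `1.18836814 < M(c18_01) < 1.18836815`. -/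
theorem c18_01_measure_enclosure :
    (118836814 / 10 ^ 8 : ℝ) < intMahlerMeasure (ofCoeffs c18_01) ∧
      intMahlerMeasure (ofCoeffs c18_01) < 118836815 / 10 ^ 8 := by
  rw [ofCoeffs_c18_01_eq, intMahlerMeasure_comp_neg_X]; exact mrwPoly18_measure_enclosure

/-- From an enclosure inside `[1, 13/10]` to the census bounds. -/
theorem census_bounds_of_enclosure {M lo hi : ℝ} (h : lo < M ∧ M < hi) (h1 : 1 ≤ lo) (h2 : hi ≤ 13 / 10) :
    1 < M ∧ M < 13 / 10 :=
  ⟨lt_of_le_of_lt h1 h.1, lt_of_lt_of_le h.2 h2⟩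

/-- `M(P) ≤ M(R)` from disjoint enclosures. -/
theorem le_of_enclosures {M N lo hi lo' hi' : ℝ} (hM : lo < M ∧ M < hi) (hN : lo' < N ∧ N < hi') (h : hi ≤ lo') :
    M ≤ N := by linarith [hM.2, hN.1]

/-- **Degree 10: every listed core has `1 < M < 13/10`** (7 cores). -/
theorem coresDeg10_measure_bounds :
    ∀ l ∈ coresDeg10, 1 < intMahlerMeasure (ofCoeffs l) ∧ intMahlerMeasure (ofCoeffs l) < 13 / 10 := by
  intro l hl
  simp only [coresDeg10, List.mem_cons, List.mem_nil_iff, or_false] at hl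
  rcases hl with rfl | rfl | rfl | rfl | rfl | rfl | rfl
  · exact census_bounds_of_enclosure c10_01_measure_enclosure (by norm_num) (by norm_num)
  · exact census_bounds_of_enclosure c10_02_measure_enclosure (by norm_num) (by norm_num)
  · exact census_bounds_of_enclosure c10_03_measure_enclosure (by norm_num) (by norm_num)
  · exact census_bounds_of_enclosure c10_04_measure_enclosure (by norm_num) (by norm_num)
  · exact census_bounds_of_enclosure c10_05_measure_enclosure (by norm_num) (by norm_num)
  · exact census_bounds_of_enclosure c10_06_measure_enclosure (by norm_num) (by norm_num)
  · exact census_bounds_of_enclosure c10_07_measure_enclosure (by norm_num) (by norm_num)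

/-- **Degree 10: the row minimum is MRW's `M_{10}`** — `M(mrwMinimalPoly 10) ≤ M(l)` for every listed core, with equality
at `c10_01 = mrwMinimalPoly 10 (-x)`. -/
theorem coresDeg10_min :
    ∀ l ∈ coresDeg10, intMahlerMeasure (mrwMinimalPoly 10) ≤ intMahlerMeasure (ofCoeffs l) := by
  have hmin : intMahlerMeasure (mrwMinimalPoly 10) = intMahlerMeasure (ofCoeffs c10_01) := by
    rw [ofCoeffs_c10_01_eq, intMahlerMeasure_comp_neg_X]; rfl
  intro l hl
  simp only [coresDeg10, List.mem_cons, List.mem_nil_iff, or_false] at hl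
  rcases hl with rfl | rfl | rfl | rfl | rfl | rfl | rfl
  · exact le_of_eq hmin
  · exact le_of_enclosures lehmerPolynomial_measure_enclosure c10_02_measure_enclosure (by norm_num)
  · exact le_of_enclosures lehmerPolynomial_measure_enclosure c10_03_measure_enclosure (by norm_num)
  · exact le_of_enclosures lehmerPolynomial_measure_enclosure c10_04_measure_enclosure (by norm_num)
  · exact le_of_enclosures lehmerPolynomial_measure_enclosure c10_05_measure_enclosure (by norm_num)
  · exact le_of_enclosures lehmerPolynomial_measure_enclosure c10_06_measure_enclosure (by norm_num)
  · exact le_of_enclosures lehmerPolynomial_measure_enclosure c10_07_measure_enclosure (by norm_num)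

/-- **Degree 12: every listed core has `1 < M < 13/10`** (5 cores). -/
theorem coresDeg12_measure_bounds :
    ∀ l ∈ coresDeg12, 1 < intMahlerMeasure (ofCoeffs l) ∧ intMahlerMeasure (ofCoeffs l) < 13 / 10 := by
  intro l hl
  simp only [coresDeg12, List.mem_cons, List.mem_nil_iff, or_false] at hl
  rcases hl with rfl | rfl | rfl | rfl | rfl
  · exact census_bounds_of_enclosure c12_01_measure_enclosure (by norm_num) (by norm_num)
  · exact census_bounds_of_enclosure c12_02_measure_enclosure (by norm_num) (by norm_num)
  · exact census_bounds_of_enclosure c12_03_measure_enclosure (by norm_num) (by norm_num)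
  · exact census_bounds_of_enclosure c12_04_measure_enclosure (by norm_num) (by norm_num)
  · exact census_bounds_of_enclosure c12_05_measure_enclosure (by norm_num) (by norm_num)

/-- **Degree 12: the row minimum is MRW's `M_{12}`** — `M(mrwMinimalPoly 12) ≤ M(l)` for every listed core, with equality
at `c12_01 = mrwMinimalPoly 12 (-x)`. -/
theorem coresDeg12_min :
    ∀ l ∈ coresDeg12, intMahlerMeasure (mrwMinimalPoly 12) ≤ intMahlerMeasure (ofCoeffs l) := by
  have hmin : intMahlerMeasure (mrwMinimalPoly 12) = intMahlerMeasure (ofCoeffs c12_01) := by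
    rw [ofCoeffs_c12_01_eq, intMahlerMeasure_comp_neg_X]; rfl
  intro l hl
  simp only [coresDeg12, List.mem_cons, List.mem_nil_iff, or_false] at hl
  rcases hl with rfl | rfl | rfl | rfl | rfl
  · exact le_of_eq hmin
  · exact le_of_enclosures mrwPoly12_measure_enclosure c12_02_measure_enclosure (by norm_num)
  · exact le_of_enclosures mrwPoly12_measure_enclosure c12_03_measure_enclosure (by norm_num)
  · exact le_of_enclosures mrwPoly12_measure_enclosure c12_04_measure_enclosure (by norm_num)
  · exact le_of_enclosures mrwPoly12_measure_enclosure c12_05_measure_enclosure (by norm_num)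

/-- **Degree 14: every listed core has `1 < M < 13/10`** (11 cores). -/
theorem coresDeg14_measure_bounds :
    ∀ l ∈ coresDeg14, 1 < intMahlerMeasure (ofCoeffs l) ∧ intMahlerMeasure (ofCoeffs l) < 13 / 10 := by
  intro l hl
  simp only [coresDeg14, List.mem_cons, List.mem_nil_iff, or_false] at hl
  rcases hl with rfl | rfl | rfl | rfl | rfl | rfl | rfl | rfl | rfl | rfl | rfl
  · exact census_bounds_of_enclosure c14_01_measure_enclosure (by norm_num) (by norm_num)
  · exact census_bounds_of_enclosure c14_02_measure_enclosure (by norm_num) (by norm_num)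
  · exact census_bounds_of_enclosure c14_03_measure_enclosure (by norm_num) (by norm_num)
  · exact census_bounds_of_enclosure c14_04_measure_enclosure (by norm_num) (by norm_num)
  · exact census_bounds_of_enclosure c14_05_measure_enclosure (by norm_num) (by norm_num)
  · exact census_bounds_of_enclosure c14_06_measure_enclosure (by norm_num) (by norm_num)
  · exact census_bounds_of_enclosure c14_07_measure_enclosure (by norm_num) (by norm_num)
  · exact census_bounds_of_enclosure c14_08_measure_enclosure (by norm_num) (by norm_num)
  · exact census_bounds_of_enclosure c14_09_measure_enclosure (by norm_num) (by norm_num)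
  · exact census_bounds_of_enclosure c14_10_measure_enclosure (by norm_num) (by norm_num)
  · exact census_bounds_of_enclosure c14_11_measure_enclosure (by norm_num) (by norm_num)

/-- **Degree 14: the row minimum is MRW's `M_{14}`** — `M(mrwMinimalPoly 14) ≤ M(l)` for every listed core, with equality
at `c14_01 = mrwMinimalPoly 14 (-x)`. -/
theorem coresDeg14_min :
    ∀ l ∈ coresDeg14, intMahlerMeasure (mrwMinimalPoly 14) ≤ intMahlerMeasure (ofCoeffs l) := by
  have hmin : intMahlerMeasure (mrwMinimalPoly 14) = intMahlerMeasure (ofCoeffs c14_01) := by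
    rw [ofCoeffs_c14_01_eq, intMahlerMeasure_comp_neg_X]; rfl
  intro l hl
  simp only [coresDeg14, List.mem_cons, List.mem_nil_iff, or_false] at hl
  rcases hl with rfl | rfl | rfl | rfl | rfl | rfl | rfl | rfl | rfl | rfl | rfl
  · exact le_of_eq hmin
  · exact le_of_enclosures mrwPoly14_measure_enclosure c14_02_measure_enclosure (by norm_num)
  · exact le_of_enclosures mrwPoly14_measure_enclosure c14_03_measure_enclosure (by norm_num)
  · exact le_of_enclosures mrwPoly14_measure_enclosure c14_04_measure_enclosure (by norm_num)
  · exact le_of_enclosures mrwPoly14_measure_enclosure c14_05_measure_enclosure (by norm_num)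
  · exact le_of_enclosures mrwPoly14_measure_enclosure c14_06_measure_enclosure (by norm_num)
  · exact le_of_enclosures mrwPoly14_measure_enclosure c14_07_measure_enclosure (by norm_num)
  · exact le_of_enclosures mrwPoly14_measure_enclosure c14_08_measure_enclosure (by norm_num)
  · exact le_of_enclosures mrwPoly14_measure_enclosure c14_09_measure_enclosure (by norm_num)
  · exact le_of_enclosures mrwPoly14_measure_enclosure c14_10_measure_enclosure (by norm_num)
  · exact le_of_enclosures mrwPoly14_measure_enclosure c14_11_measure_enclosure (by norm_num)

/-- **Degree 16: every listed core has `1 < M < 13/10`** (16 cores). -/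
theorem coresDeg16_measure_bounds :
    ∀ l ∈ coresDeg16, 1 < intMahlerMeasure (ofCoeffs l) ∧ intMahlerMeasure (ofCoeffs l) < 13 / 10 := by
  intro l hl
  simp only [coresDeg16, List.mem_cons, List.mem_nil_iff, or_false] at hl
  rcases hl with rfl | rfl | rfl | rfl | rfl | rfl | rfl | rfl | rfl | rfl | rfl | rfl | rfl | rfl | rfl | rfl
  · exact census_bounds_of_enclosure c16_01_measure_enclosure (by norm_num) (by norm_num)
  · exact census_bounds_of_enclosure c16_02_measure_enclosure (by norm_num) (by norm_num)
  · exact census_bounds_of_enclosure c16_03_measure_enclosure (by norm_num) (by norm_num)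
  · exact census_bounds_of_enclosure c16_04_measure_enclosure (by norm_num) (by norm_num)
  · exact census_bounds_of_enclosure c16_05_measure_enclosure (by norm_num) (by norm_num)
  · exact census_bounds_of_enclosure c16_06_measure_enclosure (by norm_num) (by norm_num)
  · exact census_bounds_of_enclosure c16_07_measure_enclosure (by norm_num) (by norm_num)
  · exact census_bounds_of_enclosure c16_08_measure_enclosure (by norm_num) (by norm_num)
  · exact census_bounds_of_enclosure c16_09_measure_enclosure (by norm_num) (by norm_num)
  · exact census_bounds_of_enclosure c16_10_measure_enclosure (by norm_num) (by norm_num)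
  · exact census_bounds_of_enclosure c16_11_measure_enclosure (by norm_num) (by norm_num)
  · exact census_bounds_of_enclosure c16_12_measure_enclosure (by norm_num) (by norm_num)
  · exact census_bounds_of_enclosure c16_13_measure_enclosure (by norm_num) (by norm_num)
  · exact census_bounds_of_enclosure c16_14_measure_enclosure (by norm_num) (by norm_num)
  · exact census_bounds_of_enclosure c16_15_measure_enclosure (by norm_num) (by norm_num)
  · exact census_bounds_of_enclosure c16_16_measure_enclosure (by norm_num) (by norm_num)

/-- **Degree 16: the row minimum is MRW's `M_{16}`** — `M(mrwMinimalPoly 16) ≤ M(l)` for every listed core, with equality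
at `c16_01 = mrwMinimalPoly 16 (-x)`. -/
theorem coresDeg16_min :
    ∀ l ∈ coresDeg16, intMahlerMeasure (mrwMinimalPoly 16) ≤ intMahlerMeasure (ofCoeffs l) := by
  have hmin : intMahlerMeasure (mrwMinimalPoly 16) = intMahlerMeasure (ofCoeffs c16_01) := by
    rw [ofCoeffs_c16_01_eq, intMahlerMeasure_comp_neg_X]; rfl
  intro l hl
  simp only [coresDeg16, List.mem_cons, List.mem_nil_iff, or_false] at hl
  rcases hl with rfl | rfl | rfl | rfl | rfl | rfl | rfl | rfl | rfl | rfl | rfl | rfl | rfl | rfl | rfl | rfl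
  · exact le_of_eq hmin
  · exact le_of_enclosures mrwPoly16_measure_enclosure c16_02_measure_enclosure (by norm_num)
  · exact le_of_enclosures mrwPoly16_measure_enclosure c16_03_measure_enclosure (by norm_num)
  · exact le_of_enclosures mrwPoly16_measure_enclosure c16_04_measure_enclosure (by norm_num)
  · exact le_of_enclosures mrwPoly16_measure_enclosure c16_05_measure_enclosure (by norm_num)
  · exact le_of_enclosures mrwPoly16_measure_enclosure c16_06_measure_enclosure (by norm_num)
  · exact le_of_enclosures mrwPoly16_measure_enclosure c16_07_measure_enclosure (by norm_num)
  · exact le_of_enclosures mrwPoly16_measure_enclosure c16_08_measure_enclosure (by norm_num)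
  · exact le_of_enclosures mrwPoly16_measure_enclosure c16_09_measure_enclosure (by norm_num)
  · exact le_of_enclosures mrwPoly16_measure_enclosure c16_10_measure_enclosure (by norm_num)
  · exact le_of_enclosures mrwPoly16_measure_enclosure c16_11_measure_enclosure (by norm_num)
  · exact le_of_enclosures mrwPoly16_measure_enclosure c16_12_measure_enclosure (by norm_num)
  · exact le_of_enclosures mrwPoly16_measure_enclosure c16_13_measure_enclosure (by norm_num)
  · exact le_of_enclosures mrwPoly16_measure_enclosure c16_14_measure_enclosure (by norm_num)
  · exact le_of_enclosures mrwPoly16_measure_enclosure c16_15_measure_enclosure (by norm_num)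
  · exact le_of_enclosures mrwPoly16_measure_enclosure c16_16_measure_enclosure (by norm_num)

/-- **Degree 18: every listed core has `1 < M < 13/10`** (23 cores). -/
theorem coresDeg18_measure_bounds :
    ∀ l ∈ coresDeg18, 1 < intMahlerMeasure (ofCoeffs l) ∧ intMahlerMeasure (ofCoeffs l) < 13 / 10 := by
  intro l hl
  simp only [coresDeg18, List.mem_cons, List.mem_nil_iff, or_false] at hl
  rcases hl with rfl | rfl | rfl | rfl | rfl | rfl | rfl | rfl | rfl | rfl | rfl | rfl | rfl | rfl | rfl | rfl | rfl | rfl | rfl | rfl | rfl | rfl | rfl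
  · exact census_bounds_of_enclosure c18_01_measure_enclosure (by norm_num) (by norm_num)
  · exact census_bounds_of_enclosure c18_02_measure_enclosure (by norm_num) (by norm_num)
  · exact census_bounds_of_enclosure c18_03_measure_enclosure (by norm_num) (by norm_num)
  · exact census_bounds_of_enclosure c18_04_measure_enclosure (by norm_num) (by norm_num)
  · exact census_bounds_of_enclosure c18_05_measure_enclosure (by norm_num) (by norm_num)
  · exact census_bounds_of_enclosure c18_06_measure_enclosure (by norm_num) (by norm_num)
  · exact census_bounds_of_enclosure c18_07_measure_enclosure (by norm_num) (by norm_num)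
  · exact census_bounds_of_enclosure c18_08_measure_enclosure (by norm_num) (by norm_num)
  · exact census_bounds_of_enclosure c18_09_measure_enclosure (by norm_num) (by norm_num)
  · exact census_bounds_of_enclosure c18_10_measure_enclosure (by norm_num) (by norm_num)
  · exact census_bounds_of_enclosure c18_11_measure_enclosure (by norm_num) (by norm_num)
  · exact census_bounds_of_enclosure c18_12_measure_enclosure (by norm_num) (by norm_num)
  · exact census_bounds_of_enclosure c18_13_measure_enclosure (by norm_num) (by norm_num)
  · exact census_bounds_of_enclosure c18_14_measure_enclosure (by norm_num) (by norm_num)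
  · exact census_bounds_of_enclosure c18_15_measure_enclosure (by norm_num) (by norm_num)
  · exact census_bounds_of_enclosure c18_16_measure_enclosure (by norm_num) (by norm_num)
  · exact census_bounds_of_enclosure c18_17_measure_enclosure (by norm_num) (by norm_num)
  · exact census_bounds_of_enclosure c18_18_measure_enclosure (by norm_num) (by norm_num)
  · exact census_bounds_of_enclosure c18_19_measure_enclosure (by norm_num) (by norm_num)
  · exact census_bounds_of_enclosure c18_20_measure_enclosure (by norm_num) (by norm_num)
  · exact census_bounds_of_enclosure c18_21_measure_enclosure (by norm_num) (by norm_num)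
  · exact census_bounds_of_enclosure c18_22_measure_enclosure (by norm_num) (by norm_num)
  · exact census_bounds_of_enclosure c18_23_measure_enclosure (by norm_num) (by norm_num)

/-- **Degree 18: the row minimum is MRW's `M_{18}`** — `M(mrwMinimalPoly 18) ≤ M(l)` for every listed core, with equality
at `c18_01 = mrwMinimalPoly 18 (-x)`. -/
theorem coresDeg18_min :
    ∀ l ∈ coresDeg18, intMahlerMeasure (mrwMinimalPoly 18) ≤ intMahlerMeasure (ofCoeffs l) := by
  have hmin : intMahlerMeasure (mrwMinimalPoly 18) = intMahlerMeasure (ofCoeffs c18_01) := by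
    rw [ofCoeffs_c18_01_eq, intMahlerMeasure_comp_neg_X]; rfl
  intro l hl
  simp only [coresDeg18, List.mem_cons, List.mem_nil_iff, or_false] at hl
  rcases hl with rfl | rfl | rfl | rfl | rfl | rfl | rfl | rfl | rfl | rfl | rfl | rfl | rfl | rfl | rfl | rfl | rfl | rfl | rfl | rfl | rfl | rfl | rfl
  · exact le_of_eq hmin
  · exact le_of_enclosures mrwPoly18_measure_enclosure c18_02_measure_enclosure (by norm_num)
  · exact le_of_enclosures mrwPoly18_measure_enclosure c18_03_measure_enclosure (by norm_num)
  · exact le_of_enclosures mrwPoly18_measure_enclosure c18_04_measure_enclosure (by norm_num)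
  · exact le_of_enclosures mrwPoly18_measure_enclosure c18_05_measure_enclosure (by norm_num)
  · exact le_of_enclosures mrwPoly18_measure_enclosure c18_06_measure_enclosure (by norm_num)
  · exact le_of_enclosures mrwPoly18_measure_enclosure c18_07_measure_enclosure (by norm_num)
  · exact le_of_enclosures mrwPoly18_measure_enclosure c18_08_measure_enclosure (by norm_num)
  · exact le_of_enclosures mrwPoly18_measure_enclosure c18_09_measure_enclosure (by norm_num)
  · exact le_of_enclosures mrwPoly18_measure_enclosure c18_10_measure_enclosure (by norm_num)
  · exact le_of_enclosures mrwPoly18_measure_enclosure c18_11_measure_enclosure (by norm_num)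
  · exact le_of_enclosures mrwPoly18_measure_enclosure c18_12_measure_enclosure (by norm_num)
  · exact le_of_enclosures mrwPoly18_measure_enclosure c18_13_measure_enclosure (by norm_num)
  · exact le_of_enclosures mrwPoly18_measure_enclosure c18_14_measure_enclosure (by norm_num)
  · exact le_of_enclosures mrwPoly18_measure_enclosure c18_15_measure_enclosure (by norm_num)
  · exact le_of_enclosures mrwPoly18_measure_enclosure c18_16_measure_enclosure (by norm_num)
  · exact le_of_enclosures mrwPoly18_measure_enclosure c18_17_measure_enclosure (by norm_num)
  · exact le_of_enclosures mrwPoly18_measure_enclosure c18_18_measure_enclosure (by norm_num)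
  · exact le_of_enclosures mrwPoly18_measure_enclosure c18_19_measure_enclosure (by norm_num)
  · exact le_of_enclosures mrwPoly18_measure_enclosure c18_20_measure_enclosure (by norm_num)
  · exact le_of_enclosures mrwPoly18_measure_enclosure c18_21_measure_enclosure (by norm_num)
  · exact le_of_enclosures mrwPoly18_measure_enclosure c18_22_measure_enclosure (by norm_num)
  · exact le_of_enclosures mrwPoly18_measure_enclosure c18_23_measure_enclosure (by norm_num)

/-- **Isolation of Lehmer's measure in degrees `≤ 18`**: every census core of degree `10–18` other than
`c10_01 = ℓ(-x)` has `M > 1.1883` (`> λ₀ + 0.012`; the runner-up is `c18_01`, `M = 1.18836814…`). -/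
theorem census_le18_gap :
    ∀ l ∈ coresDeg10 ++ coresDeg12 ++ coresDeg14 ++ coresDeg16 ++ coresDeg18, l ≠ c10_01 →
      (11883 / 10 ^ 4 : ℝ) < intMahlerMeasure (ofCoeffs l) := by
  intro l hl hne
  simp only [coresDeg10, coresDeg12, coresDeg14, coresDeg16, coresDeg18, List.cons_append, List.nil_append,
    List.mem_cons, List.mem_nil_iff, or_false] at hl
  rcases hl with rfl | rfl | rfl | rfl | rfl | rfl | rfl | rfl | rfl | rfl | rfl | rfl | rfl | rfl | rfl | rfl | rfl | rfl | rfl | rfl | rfl | rfl | rfl | rfl | rfl | rfl | rfl | rfl | rfl | rfl | rfl | rfl | rfl | rfl | rfl | rfl | rfl | rfl | rfl | rfl | rfl | rfl | rfl | rfl | rfl | rfl | rfl | rfl | rfl | rfl | rfl | rfl | rfl | rfl | rfl | rfl | rfl | rfl | rfl | rfl | rfl | rfl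
  · exact absurd rfl hne
  · exact lt_of_le_of_lt (by norm_num) c10_02_measure_enclosure.1
  · exact lt_of_le_of_lt (by norm_num) c10_03_measure_enclosure.1
  · exact lt_of_le_of_lt (by norm_num) c10_04_measure_enclosure.1
  · exact lt_of_le_of_lt (by norm_num) c10_05_measure_enclosure.1
  · exact lt_of_le_of_lt (by norm_num) c10_06_measure_enclosure.1
  · exact lt_of_le_of_lt (by norm_num) c10_07_measure_enclosure.1
  · exact lt_of_le_of_lt (by norm_num) c12_01_measure_enclosure.1
  · exact lt_of_le_of_lt (by norm_num) c12_02_measure_enclosure.1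
  · exact lt_of_le_of_lt (by norm_num) c12_03_measure_enclosure.1
  · exact lt_of_le_of_lt (by norm_num) c12_04_measure_enclosure.1
  · exact lt_of_le_of_lt (by norm_num) c12_05_measure_enclosure.1
  · exact lt_of_le_of_lt (by norm_num) c14_01_measure_enclosure.1
  · exact lt_of_le_of_lt (by norm_num) c14_02_measure_enclosure.1
  · exact lt_of_le_of_lt (by norm_num) c14_03_measure_enclosure.1
  · exact lt_of_le_of_lt (by norm_num) c14_04_measure_enclosure.1
  · exact lt_of_le_of_lt (by norm_num) c14_05_measure_enclosure.1
  · exact lt_of_le_of_lt (by norm_num) c14_06_measure_enclosure.1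
  · exact lt_of_le_of_lt (by norm_num) c14_07_measure_enclosure.1
  · exact lt_of_le_of_lt (by norm_num) c14_08_measure_enclosure.1
  · exact lt_of_le_of_lt (by norm_num) c14_09_measure_enclosure.1
  · exact lt_of_le_of_lt (by norm_num) c14_10_measure_enclosure.1
  · exact lt_of_le_of_lt (by norm_num) c14_11_measure_enclosure.1
  · exact lt_of_le_of_lt (by norm_num) c16_01_measure_enclosure.1
  · exact lt_of_le_of_lt (by norm_num) c16_02_measure_enclosure.1
  · exact lt_of_le_of_lt (by norm_num) c16_03_measure_enclosure.1
  · exact lt_of_le_of_lt (by norm_num) c16_04_measure_enclosure.1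
  · exact lt_of_le_of_lt (by norm_num) c16_05_measure_enclosure.1
  · exact lt_of_le_of_lt (by norm_num) c16_06_measure_enclosure.1
  · exact lt_of_le_of_lt (by norm_num) c16_07_measure_enclosure.1
  · exact lt_of_le_of_lt (by norm_num) c16_08_measure_enclosure.1
  · exact lt_of_le_of_lt (by norm_num) c16_09_measure_enclosure.1
  · exact lt_of_le_of_lt (by norm_num) c16_10_measure_enclosure.1
  · exact lt_of_le_of_lt (by norm_num) c16_11_measure_enclosure.1
  · exact lt_of_le_of_lt (by norm_num) c16_12_measure_enclosure.1
  · exact lt_of_le_of_lt (by norm_num) c16_13_measure_enclosure.1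
  · exact lt_of_le_of_lt (by norm_num) c16_14_measure_enclosure.1
  · exact lt_of_le_of_lt (by norm_num) c16_15_measure_enclosure.1
  · exact lt_of_le_of_lt (by norm_num) c16_16_measure_enclosure.1
  · exact lt_of_le_of_lt (by norm_num) c18_01_measure_enclosure.1
  · exact lt_of_le_of_lt (by norm_num) c18_02_measure_enclosure.1
  · exact lt_of_le_of_lt (by norm_num) c18_03_measure_enclosure.1
  · exact lt_of_le_of_lt (by norm_num) c18_04_measure_enclosure.1
  · exact lt_of_le_of_lt (by norm_num) c18_05_measure_enclosure.1
  · exact lt_of_le_of_lt (by norm_num) c18_06_measure_enclosure.1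
  · exact lt_of_le_of_lt (by norm_num) c18_07_measure_enclosure.1
  · exact lt_of_le_of_lt (by norm_num) c18_08_measure_enclosure.1
  · exact lt_of_le_of_lt (by norm_num) c18_09_measure_enclosure.1
  · exact lt_of_le_of_lt (by norm_num) c18_10_measure_enclosure.1
  · exact lt_of_le_of_lt (by norm_num) c18_11_measure_enclosure.1
  · exact lt_of_le_of_lt (by norm_num) c18_12_measure_enclosure.1
  · exact lt_of_le_of_lt (by norm_num) c18_13_measure_enclosure.1
  · exact lt_of_le_of_lt (by norm_num) c18_14_measure_enclosure.1
  · exact lt_of_le_of_lt (by norm_num) c18_15_measure_enclosure.1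
  · exact lt_of_le_of_lt (by norm_num) c18_16_measure_enclosure.1
  · exact lt_of_le_of_lt (by norm_num) c18_17_measure_enclosure.1
  · exact lt_of_le_of_lt (by norm_num) c18_18_measure_enclosure.1
  · exact lt_of_le_of_lt (by norm_num) c18_19_measure_enclosure.1
  · exact lt_of_le_of_lt (by norm_num) c18_20_measure_enclosure.1
  · exact lt_of_le_of_lt (by norm_num) c18_21_measure_enclosure.1
  · exact lt_of_le_of_lt (by norm_num) c18_22_measure_enclosure.1
  · exact lt_of_le_of_lt (by norm_num) c18_23_measure_enclosure.1

end Summit.Ventures.DiscreteObjects.Mahler
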